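import Literature.NumberTheory.DiophantineApproximation.ViolaZudilinLemma21
import Literature.NumberTheory.DiophantineApproximation.ViolaZudilinPhiTransformation
import Literature.NumberTheory.DiophantineApproximation.PolylogLogFunctionalIndependence
import Literature.NumberTheory.DiophantineApproximation.FactorialRatioPrimeClasses
import HarnessLib

/-!
# Viola–Zudilin 2018, Proposition 3.1 (the `ϕ`-part): invariance of `P, Q, R` and the extra primes

Topic `Literature/NumberTheory/DiophantineApproximation`. PROVED theorems only; no new definitions,
no named facts.

For a tuple `T = (h,j,k,l,m,q)` with `k ≤ h+m`, `m ≤ j+k`, `m ≤ j+q` let `ϕT = (h+m−k, j+k−m, m, l, k, q)`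
(`ϕ = (h h+m−k)(j j+k−m)(k m)`, VZ Lemma 3.2). The exponents `α, β, δ` of Lemma 2.1 are `ϕ`-invariant
(`alpha_phi`, `beta_phi`, `delta_phi`); let `d_{H₀} d_{H₀'}` be any common multiple of the two `d_H d_{H'}`.

* `lemma21_phi` — **Prop. 3.1, lines 1 and 4, with the `ϕ`-relation**: there are `P, Q, R` (for `T`) and
  `P', Q', R'` (for `ϕT`) in `ℤ[X]` of degrees `≤ δ` satisfying the three identities of Lemma 2.1 with
  the COMMON normaliser `N₀(z) = d_{H₀} d_{H₀'} z^α (1−z)^β`, and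
  `(h+m−k)! (j+k−m)! · (P, Q, R) = h! j! · (P', Q', R')` in `ℤ[X]`.
  Proof: Lemma 2.1 twice (scaled to `N₀`); `N₀ J^{(0)} = P − Q Li₂ + log z (R − Q Li₁)` for both tuples;
  the real identity `(h+m−k)!(j+k−m)! J^{(0)}(T) = h!j! J^{(0)}(ϕT)` (`J₀_phi`, Euler's hypergeometric
  transformation); uniqueness of such representations (`polylog_log_representation_unique`). This
  replaces the contour-integral interchange of [RV, (3.6)] / VZ Lemma 3.2 for `μ = 1, 2`.
* `prime_dvd_coeff_of_phi` — **the arithmetic gain** [RV, pp. 418–419, (4.5)–(4.6); VZ §6.1]: for the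
  `n`-scaled tuple `(hn, jn, kn, ln, mn, qn)`, every prime `p` with `p² > max{h, j, h+m−k, j+k−m}·n` and
  `⌊(h+m−k)ω⌋ + ⌊(j+k−m)ω⌋ < ⌊hω⌋ + ⌊jω⌋`, `ω = {n/p}`, divides every coefficient of `P, Q, R`.

## References

* C. Viola, W. Zudilin, J. reine angew. Math. 736 (2018) 193–223, Lemma 3.2, Prop. 3.1, §6.1 (6.1).
  [ViolaZudilin2018]
* G. Rhin, C. Viola, Ann. Sc. Norm. Super. Pisa Cl. Sci. (5) 4 (2005) 389–437, (3.5)–(3.7), (4.5)–(4.6).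
  [RhinViola2005]
-/

noncomputable section

namespace Literature.NumberTheory.DiophantineApproximation

namespace ViolaZudilin

open Finset Polynomial
open scoped Nat
open DilogPade (polylogSeries polylog_log_representation_unique)
open Literature.NumberTheory.LFunctions (lcmUpto_dvd_lcmUpto_of_le)

/-! ### `ϕ`-invariance of the exponents -/

/-- `α` is `ϕ`-invariant. [cite: ViolaZudilin2018, §3.2] -/
theorem alpha_phi (h j k l m q : ℕ) : alpha (h + m - k) (j + k - m) m l k q = alpha h j k l m q := by
  unfold alpha; exact max_comm _ _

/-- `β` is `ϕ`-invariant (`k ≤ h+m`). [cite: ViolaZudilin2018, §3.2] -/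
theorem beta_phi {h k m : ℕ} (hk : k ≤ h + m) (j l q : ℕ) : beta (h + m - k) (j + k - m) m l k q = beta h j k l m q := by
  unfold beta; omega

/-- `δ` is `ϕ`-invariant (`k ≤ h+m`, `m ≤ j+k`). [cite: ViolaZudilin2018, §3.2] -/
theorem delta_phi {h j k m : ℕ} (hk : k ≤ h + m) (hm : m ≤ j + k) (l q : ℕ) :
    delta (h + m - k) (j + k - m) m l k q = delta h j k l m q := by
  unfold delta; rw [alpha_phi, beta_phi hk]; unfold beta; omega

/-! ### Scaling Lemma 2.1 to a larger normaliser -/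

/-- `aeval z (C c · P) = c · aeval z P`. [folklore] -/
theorem aeval_C_mul' (c : ℤ) (P : ℤ[X]) (z : ℝ) : aeval z (C c * P) = (c : ℝ) * aeval z P := by
  rw [map_mul, aeval_C, algebraMap_int_eq, eq_intCast]

/-- Lemma 2.1 with any normaliser `d_{H₀} d_{H₀'}`, `H ≤ H₀`, `H' ≤ H₀'`. [cite: ViolaZudilin2018, Lemma 2.1] -/
theorem lemma21_of_le {h j k l m q : ℕ} (hm : m ≤ j + k) (hq : m ≤ j + q) {H₀ H₀' : ℕ}
    (hH : bigH h j k l m q ≤ H₀) (hH' : bigH' h j k l m q ≤ H₀') :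
    ∃ P Q R : ℤ[X], P.natDegree ≤ delta h j k l m q ∧ Q.natDegree ≤ delta h j k l m q ∧
      R.natDegree ≤ delta h j k l m q ∧
      ∀ z : ℝ, 1 < z →
        (Nat.lcmUpto H₀ : ℝ) * Nat.lcmUpto H₀' * z ^ alpha h j k l m q * (1 - z) ^ beta h j k l m q *
            J z h j k l m q = aeval z P - aeval z Q * polylogSeries 2 (1 / z) ∧
        (Nat.lcmUpto H₀ : ℝ) * Nat.lcmUpto H₀' * z ^ alpha h j k l m q * (1 - z) ^ beta h j k l m q *
            J₁ z h j k l m q = aeval z R - aeval z Q * polylogSeries 1 (1 / z) ∧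
        (Nat.lcmUpto H₀ : ℝ) * Nat.lcmUpto H₀' * z ^ alpha h j k l m q * (1 - z) ^ beta h j k l m q *
            J₂ z h j k l m q = aeval z Q := by
  obtain ⟨P, Q, R, hP, hQ, hR, hid⟩ := lemma21 hm hq
  have hdvd : Nat.lcmUpto (bigH h j k l m q) * Nat.lcmUpto (bigH' h j k l m q) ∣ Nat.lcmUpto H₀ * Nat.lcmUpto H₀' :=
    mul_dvd_mul (lcmUpto_dvd_lcmUpto_of_le hH) (lcmUpto_dvd_lcmUpto_of_le hH')
  obtain ⟨ρ, hρ⟩ := hdvd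
  have hρ' : (Nat.lcmUpto H₀ : ℝ) * Nat.lcmUpto H₀' =
      ρ * ((Nat.lcmUpto (bigH h j k l m q) : ℝ) * Nat.lcmUpto (bigH' h j k l m q)) := by
    rw [mul_comm (ρ : ℝ)]; exact_mod_cast hρ
  refine ⟨C (ρ : ℤ) * P, C (ρ : ℤ) * Q, C (ρ : ℤ) * R, (natDegree_C_mul_le _ _).trans hP,
    (natDegree_C_mul_le _ _).trans hQ, (natDegree_C_mul_le _ _).trans hR, fun z hz => ?_⟩
  obtain ⟨e0, e1, e2⟩ := hid z hz
  simp only [aeval_C_mul', Int.cast_natCast]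
  refine ⟨?_, ?_, ?_⟩
  · rw [hρ']; linear_combination (ρ : ℝ) * e0
  · rw [hρ']; linear_combination (ρ : ℝ) * e1
  · rw [hρ']; linear_combination (ρ : ℝ) * e2

/-! ### The transfer -/

/-- **Viola–Zudilin Prop. 3.1 (`ϕ`-part)**: Lemma 2.1 for `T` and `ϕT` with a common normaliser, degrees
`≤ δ`, and `(h+m−k)!(j+k−m)!·(P,Q,R) = h!j!·(P',Q',R')` in `ℤ[X]`. [cite: ViolaZudilin2018, Proposition 3.1] -/
theorem lemma21_phi {h j k l m q : ℕ} (hk : k ≤ h + m) (hm : m ≤ j + k) (hq : m ≤ j + q) {H₀ H₀' : ℕ}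
    (hH : bigH h j k l m q ≤ H₀) (hH' : bigH' h j k l m q ≤ H₀')
    (hHφ : bigH (h + m - k) (j + k - m) m l k q ≤ H₀) (hH'φ : bigH' (h + m - k) (j + k - m) m l k q ≤ H₀') :
    ∃ P Q R P' Q' R' : ℤ[X],
      P.natDegree ≤ delta h j k l m q ∧ Q.natDegree ≤ delta h j k l m q ∧ R.natDegree ≤ delta h j k l m q ∧
      P'.natDegree ≤ delta h j k l m q ∧ Q'.natDegree ≤ delta h j k l m q ∧ R'.natDegree ≤ delta h j k l m q ∧
      (∀ z : ℝ, 1 < z →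
        (Nat.lcmUpto H₀ : ℝ) * Nat.lcmUpto H₀' * z ^ alpha h j k l m q * (1 - z) ^ beta h j k l m q *
            J z h j k l m q = aeval z P - aeval z Q * polylogSeries 2 (1 / z) ∧
        (Nat.lcmUpto H₀ : ℝ) * Nat.lcmUpto H₀' * z ^ alpha h j k l m q * (1 - z) ^ beta h j k l m q *
            J₁ z h j k l m q = aeval z R - aeval z Q * polylogSeries 1 (1 / z) ∧
        (Nat.lcmUpto H₀ : ℝ) * Nat.lcmUpto H₀' * z ^ alpha h j k l m q * (1 - z) ^ beta h j k l m q *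
            J₂ z h j k l m q = aeval z Q) ∧
      (∀ z : ℝ, 1 < z →
        (Nat.lcmUpto H₀ : ℝ) * Nat.lcmUpto H₀' * z ^ alpha h j k l m q * (1 - z) ^ beta h j k l m q *
            J z (h + m - k) (j + k - m) m l k q = aeval z P' - aeval z Q' * polylogSeries 2 (1 / z) ∧
        (Nat.lcmUpto H₀ : ℝ) * Nat.lcmUpto H₀' * z ^ alpha h j k l m q * (1 - z) ^ beta h j k l m q *
            J₁ z (h + m - k) (j + k - m) m l k q = aeval z R' - aeval z Q' * polylogSeries 1 (1 / z) ∧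
        (Nat.lcmUpto H₀ : ℝ) * Nat.lcmUpto H₀' * z ^ alpha h j k l m q * (1 - z) ^ beta h j k l m q *
            J₂ z (h + m - k) (j + k - m) m l k q = aeval z Q') ∧
      C (((h + m - k)! * (j + k - m)! : ℕ) : ℤ) * P = C ((h ! * j ! : ℕ) : ℤ) * P' ∧
      C (((h + m - k)! * (j + k - m)! : ℕ) : ℤ) * Q = C ((h ! * j ! : ℕ) : ℤ) * Q' ∧
      C (((h + m - k)! * (j + k - m)! : ℕ) : ℤ) * R = C ((h ! * j ! : ℕ) : ℤ) * R' := by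
  obtain ⟨P, Q, R, hP, hQ, hR, hid⟩ := lemma21_of_le hm hq hH hH'
  obtain ⟨P', Q', R', hP', hQ', hR', hid'⟩ :=
    lemma21_of_le (h := h + m - k) (j := j + k - m) (k := m) (l := l) (m := k) (q := q) (by omega) (by omega) hHφ hH'φ
  rw [delta_phi hk hm] at hP' hQ' hR'
  have hid'' : ∀ z : ℝ, 1 < z →
      (Nat.lcmUpto H₀ : ℝ) * Nat.lcmUpto H₀' * z ^ alpha h j k l m q * (1 - z) ^ beta h j k l m q *
          J z (h + m - k) (j + k - m) m l k q = aeval z P' - aeval z Q' * polylogSeries 2 (1 / z) ∧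
      (Nat.lcmUpto H₀ : ℝ) * Nat.lcmUpto H₀' * z ^ alpha h j k l m q * (1 - z) ^ beta h j k l m q *
          J₁ z (h + m - k) (j + k - m) m l k q = aeval z R' - aeval z Q' * polylogSeries 1 (1 / z) ∧
      (Nat.lcmUpto H₀ : ℝ) * Nat.lcmUpto H₀' * z ^ alpha h j k l m q * (1 - z) ^ beta h j k l m q *
          J₂ z (h + m - k) (j + k - m) m l k q = aeval z Q' := by
    intro z hz
    have := hid' z hz
    rwa [alpha_phi, beta_phi hk] at this
  set c : ℕ := (h + m - k)! * (j + k - m)! with hc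
  set c' : ℕ := h ! * j ! with hc'
  -- uniqueness transfer through `J^{(0)}`
  have huniq := polylog_log_representation_unique (P₁ := C (c : ℤ) * P) (Q₁ := C (c : ℤ) * Q) (R₁ := C (c : ℤ) * R)
    (S₁ := C (c : ℤ) * Q) (P₂ := C (c' : ℤ) * P') (Q₂ := C (c' : ℤ) * Q') (R₂ := C (c' : ℤ) * R')
    (S₂ := C (c' : ℤ) * Q') fun z hz => by
      have hz1 : 1 < z := by linarith
      obtain ⟨e0, e1, -⟩ := hid z hz1
      obtain ⟨f0, f1, -⟩ := hid'' z hz1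
      have hphi := J₀_phi hz1 hk hm hq l
      set N₀ : ℝ := (Nat.lcmUpto H₀ : ℝ) * Nat.lcmUpto H₀' * z ^ alpha h j k l m q * (1 - z) ^ beta h j k l m q
        with hN₀
      have hJ : ∀ a b c d e f : ℕ, J₀ z a b c d e f = J z a b c d e f + Real.log z * J₁ z a b c d e f := by
        intro a b c d e f; rw [J]; ring
      have g0 : N₀ * J₀ z h j k l m q = aeval z P - aeval z Q * polylogSeries 2 (1 / z) +
          Real.log z * (aeval z R - aeval z Q * polylogSeries 1 (1 / z)) := by
        rw [hJ, mul_add, e0, mul_left_comm, e1]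
      have g1 : N₀ * J₀ z (h + m - k) (j + k - m) m l k q = aeval z P' - aeval z Q' * polylogSeries 2 (1 / z) +
          Real.log z * (aeval z R' - aeval z Q' * polylogSeries 1 (1 / z)) := by
        rw [hJ, mul_add, f0, mul_left_comm, f1]
      have key : (((h + m - k)! : ℝ) * (j + k - m)!) * (N₀ * J₀ z h j k l m q) =
          ((h ! : ℝ) * j !) * (N₀ * J₀ z (h + m - k) (j + k - m) m l k q) := by
        calc (((h + m - k)! : ℝ) * (j + k - m)!) * (N₀ * J₀ z h j k l m q)
            = N₀ * ((((h + m - k)! : ℝ) * (j + k - m)!) * J₀ z h j k l m q) := by ring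
          _ = N₀ * (((h ! : ℝ) * j !) * J₀ z (h + m - k) (j + k - m) m l k q) := by rw [hphi]
          _ = _ := by ring
      rw [g0, g1] at key
      simp only [aeval_C_mul', hc, hc']
      push_cast
      linear_combination key
  obtain ⟨u0, u1, u2, -⟩ := huniq
  exact ⟨P, Q, R, P', Q', R', hP, hQ, hR, hP', hQ', hR', hid, hid'', u0, u1, u2⟩

/-! ### The arithmetic gain from `ϕ` -/

/-- Coefficientwise form of `C c · P = C c' · P'`: `c·|pᵢ| = c'·|p'ᵢ|`. [folklore] -/
theorem natAbs_coeff_mul_eq {c c' : ℕ} {P P' : ℤ[X]} (hPP : C (c : ℤ) * P = C (c' : ℤ) * P') (i : ℕ) :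
    (P.coeff i).natAbs * c = (P'.coeff i).natAbs * c' := by
  have := congrArg (fun F : ℤ[X] => F.coeff i) hPP
  simp only [coeff_C_mul] at this
  have h2 := congrArg Int.natAbs this
  rw [Int.natAbs_mul, Int.natAbs_mul, Int.natAbs_natCast, Int.natAbs_natCast] at h2
  linarith [h2]

/-- **[RV (4.5)–(4.6)] for a polynomial relation**: if `((b₁n)!(b₂n)!)·P = ((a₁n)!(a₂n)!)·P'` in `ℤ[X]`
with `a₁+a₂ = b₁+b₂`, then every prime `p` with `aᵢn, bᵢn < p²` in the class
`⌊b₁ω⌋ + ⌊b₂ω⌋ < ⌊a₁ω⌋ + ⌊a₂ω⌋` (`ω = {n/p}`) divides all coefficients of `P`.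
[cite: RhinViola2005, (4.5)–(4.6)] -/
theorem prime_dvd_coeff_of_factorial_rel {p : ℕ} [Fact p.Prime] {a₁ a₂ b₁ b₂ : ℕ} (n : ℕ)
    (hbal : a₁ + a₂ = b₁ + b₂) (ha₁ : a₁ * n < p ^ 2) (ha₂ : a₂ * n < p ^ 2) (hb₁ : b₁ * n < p ^ 2)
    (hb₂ : b₂ * n < p ^ 2)
    (hΩ : b₁ * (n % p) / p + b₂ * (n % p) / p < a₁ * (n % p) / p + a₂ * (n % p) / p)
    {P P' : ℤ[X]} (hPP : C (((b₁ * n)! * (b₂ * n)! : ℕ) : ℤ) * P = C (((a₁ * n)! * (a₂ * n)! : ℕ) : ℤ) * P')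
    (i : ℕ) : (p : ℤ) ∣ P.coeff i := by
  have h1 := natAbs_coeff_mul_eq hPP i
  have h2 : p ∣ (P.coeff i).natAbs :=
    RhinViola.dvd_of_mul_factorial_eq (p := p) n hbal ha₁ ha₂ hb₁ hb₂ hΩ (X := (P.coeff i).natAbs)
      (Y := (P'.coeff i).natAbs) h1
  exact Int.natCast_dvd.2 h2

/-- **Viola–Zudilin Prop. 3.1 with the arithmetic of §6.1, for the scaled tuple `(hn,jn,kn,ln,mn,qn)`**:
polynomials `P, Q, R ∈ ℤ[X]` of degree `≤ δ(T)·n`… — precisely: of degree `≤ delta (hn) (jn) (kn) (ln) (mn) (qn)` —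
with the three identities of Lemma 2.1 for the normaliser `d_{H₀} d_{H₀'} z^α (1−z)^β` (`α, β` of the
scaled tuple; `H₀, H₀'` any bounds for the scaled `H, H'` of `T` and `ϕT`), such that every prime `p` with
`p² > max{h, j, h+m−k, j+k−m}·n` and `⌊(h+m−k){n/p}⌋ + ⌊(j+k−m){n/p}⌋ < ⌊h{n/p}⌋ + ⌊j{n/p}⌋` divides
all coefficients of `P`, `Q` and `R`. [cite: ViolaZudilin2018, Proposition 3.1 and §6.1] -/
theorem lemma21_prime_dvd {h j k l m q : ℕ} (hk : k ≤ h + m) (hm : m ≤ j + k) (hq : m ≤ j + q) (n : ℕ)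
    {H₀ H₀' : ℕ} (hH : bigH (h * n) (j * n) (k * n) (l * n) (m * n) (q * n) ≤ H₀)
    (hH' : bigH' (h * n) (j * n) (k * n) (l * n) (m * n) (q * n) ≤ H₀')
    (hHφ : bigH ((h + m - k) * n) ((j + k - m) * n) (m * n) (l * n) (k * n) (q * n) ≤ H₀)
    (hH'φ : bigH' ((h + m - k) * n) ((j + k - m) * n) (m * n) (l * n) (k * n) (q * n) ≤ H₀') :
    ∃ P Q R : ℤ[X],
      P.natDegree ≤ delta (h * n) (j * n) (k * n) (l * n) (m * n) (q * n) ∧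
      Q.natDegree ≤ delta (h * n) (j * n) (k * n) (l * n) (m * n) (q * n) ∧
      R.natDegree ≤ delta (h * n) (j * n) (k * n) (l * n) (m * n) (q * n) ∧
      (∀ z : ℝ, 1 < z →
        (Nat.lcmUpto H₀ : ℝ) * Nat.lcmUpto H₀' * z ^ alpha (h * n) (j * n) (k * n) (l * n) (m * n) (q * n) *
            (1 - z) ^ beta (h * n) (j * n) (k * n) (l * n) (m * n) (q * n) *
            J z (h * n) (j * n) (k * n) (l * n) (m * n) (q * n) = aeval z P - aeval z Q * polylogSeries 2 (1 / z) ∧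
        (Nat.lcmUpto H₀ : ℝ) * Nat.lcmUpto H₀' * z ^ alpha (h * n) (j * n) (k * n) (l * n) (m * n) (q * n) *
            (1 - z) ^ beta (h * n) (j * n) (k * n) (l * n) (m * n) (q * n) *
            J₁ z (h * n) (j * n) (k * n) (l * n) (m * n) (q * n) = aeval z R - aeval z Q * polylogSeries 1 (1 / z) ∧
        (Nat.lcmUpto H₀ : ℝ) * Nat.lcmUpto H₀' * z ^ alpha (h * n) (j * n) (k * n) (l * n) (m * n) (q * n) *
            (1 - z) ^ beta (h * n) (j * n) (k * n) (l * n) (m * n) (q * n) *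
            J₂ z (h * n) (j * n) (k * n) (l * n) (m * n) (q * n) = aeval z Q) ∧
      ∀ (p : ℕ) [Fact p.Prime], max (max h j) (max (h + m - k) (j + k - m)) * n < p ^ 2 →
        (h + m - k) * (n % p) / p + (j + k - m) * (n % p) / p < h * (n % p) / p + j * (n % p) / p →
        ∀ i : ℕ, (p : ℤ) ∣ P.coeff i ∧ (p : ℤ) ∣ Q.coeff i ∧ (p : ℤ) ∣ R.coeff i := by
  have hmul1 : (h + m - k) * n = h * n + m * n - k * n := by rw [Nat.sub_mul, Nat.add_mul]
  have hmul2 : (j + k - m) * n = j * n + k * n - m * n := by rw [Nat.sub_mul, Nat.add_mul]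
  have hk' : k * n ≤ h * n + m * n := by rw [← Nat.add_mul]; exact Nat.mul_le_mul_right _ hk
  have hm' : m * n ≤ j * n + k * n := by rw [← Nat.add_mul]; exact Nat.mul_le_mul_right _ hm
  have hq' : m * n ≤ j * n + q * n := by rw [← Nat.add_mul]; exact Nat.mul_le_mul_right _ hq
  rw [hmul1, hmul2] at hHφ hH'φ
  obtain ⟨P, Q, R, P', Q', R', hP, hQ, hR, -, -, -, hid, -, uP, uQ, uR⟩ := lemma21_phi hk' hm' hq' hH hH' hHφ hH'φ
  refine ⟨P, Q, R, hP, hQ, hR, hid, fun p _ hp2 hΩ i => ?_⟩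
  rw [← hmul1, ← hmul2] at uP uQ uR
  have ha₁ : h * n < p ^ 2 := lt_of_le_of_lt (Nat.mul_le_mul_right _ (by omega)) hp2
  have ha₂ : j * n < p ^ 2 := lt_of_le_of_lt (Nat.mul_le_mul_right _ (by omega)) hp2
  have hb₁ : (h + m - k) * n < p ^ 2 := lt_of_le_of_lt (Nat.mul_le_mul_right _ (by omega)) hp2
  have hb₂ : (j + k - m) * n < p ^ 2 := lt_of_le_of_lt (Nat.mul_le_mul_right _ (by omega)) hp2
  have hbal : h + j = (h + m - k) + (j + k - m) := by omega
  exact ⟨prime_dvd_coeff_of_factorial_rel n hbal ha₁ ha₂ hb₁ hb₂ hΩ uP i,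
    prime_dvd_coeff_of_factorial_rel n hbal ha₁ ha₂ hb₁ hb₂ hΩ uQ i,
    prime_dvd_coeff_of_factorial_rel n hbal ha₁ ha₂ hb₁ hb₂ hΩ uR i⟩

end ViolaZudilin

end Literature.NumberTheory.DiophantineApproximation

end
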